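import Mathlib
import HarnessLib

/-!
# Route `AdditiveKolyvaginRoad`, crux `KolyvaginPrimitiveAdditive` (item stmt-BirchSwinnertonDyer-21400), stub J2
# (`stub_twoPrimeJumpAdditive`, skeleton v10): the LOCAL LINEAR ALGEBRA of the two-prime jump —
# a Lagrangian plane in the orthogonal sum of two hyperbolic planes meeting the «finite» Lagrangian in a line meets the
# «toric» Lagrangian in a line
# (cell `pub/bsd-wall`, lead prover `bsd-wall-akr-p1` g5; `--supports stmt-BirchSwinnertonDyer-21400`, helper; pure algebra)

WHY. At two Bertolini–Darmon admissible primes `q₁ ≠ q₂` (places `v₁, v₂`) the local cohomology `V_i = H¹(K_{v_i}, E[p])`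
is a hyperbolic plane for the SYMMETRIC local Tate pairing `b_i = inv_{v_i}(· ∪ₑ ·)` (Klagsbrun–Mazur–Rubin Thm. 3.1 (i)):
`#V_i = p²`, with two Lagrangian lines, the finite ∕ Kummer line `F_i` and the toric line `T_i`, `F_i ≠ T_i`. The image
`Λ` of the `{v₁, v₂}`-relaxed Selmer group in `V₁ ⊕ V₂` is Lagrangian for `b₁ ⊕ b₂` (Poitou–Tate), so `#Λ = p²`. W. Zhang's
Lemma 5.3 ∕ Prop. 5.4 at the two primes («lower at `q₁`, raise at `q₂`») is then the following statement of linear algebra,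
proved here for abstract abelian groups killed by `p`: if `Λ ∩ (F₁ ⊕ F₂)` lies on the line through `x̂ = (f₁, f₂) ∈ Λ` with
`f_i ∈ F_i ∖ T_i`, then `Λ ∩ (T₁ ⊕ T₂)` has exactly `p` elements. Proof: pick `ŷ ∈ Λ` off `ℤ x̂`, decompose its
coordinates along `V_i = F_i ⊕ T_i`, `ŷ_i = α_i f_i + w_i`; isotropy of `Λ` against `x̂` gives `c₁ + c₂ = 0`
(`c_i = b_i(w_i, f_i)`), against itself `2(α₁ c₁ + α₂ c₂) = 0` (symmetry!), so `(α₁ − α₂) c₁ = 0`; `c₁ = 0` would put `ŷ`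
in `F₁ ⊕ F₂` (non-degeneracy), so `α₁ ≡ α₂ (mod p)` and `ŷ − α₁ x̂ ∈ Λ ∩ (T₁ ⊕ T₂)` is non-zero; the intersection is
proper (`x̂ ∉ T₁ ⊕ T₂`), of order dividing `p²`, hence of order `p`. (For an ALTERNATING pairing the statement fails —
every vector is isotropic; this is the parity phenomenon of Gross–Parson ∕ Howard ∕ Mazur–Rubin at admissible primes.)

HONEST FRAMING: one abstract theorem + lemmas on groups of prime order; 0 definitions, 0 named facts, 0 `sorry`; nothing
about elliptic curves; closes nothing.

References: [cite: WZhang2014, Lemma 5.3, Prop. 5.4] [cite: KlagsbrunMazurRubin2013, Thm. 3.1 (i)]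
[cite: BertoliniDarmon2005, Lemma 2.6] [cite: MilneADT2006, Ch. I, Cor. 2.3].
-/

-- single-conjunct summit: `Summit.BirchSwinnertonDyer.BirchSwinnertonDyer.…` repeats the name by design
set_option linter.dupNamespace false

namespace Summit.BirchSwinnertonDyer.BirchSwinnertonDyer.Theorems.AdditiveKoly.TwoPlanes

/-! ## §1 Groups of prime order -/

section PrimeOrder

variable {V : Type*} [AddCommGroup V] {p : ℕ} [hp : Fact p.Prime]

/-- In a group killed by the prime `p`, a non-zero element has order `p`. [folklore] -/
theorem addOrderOf_eq_of_ne_zero (hV : ∀ v : V, p • v = 0) {v : V} (hv : v ≠ 0) : addOrderOf v = p :=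
  addOrderOf_eq_prime (hV v) hv

/-- A subgroup of order `p` is the cyclic group on any of its non-zero elements: every element is an INTEGER multiple
of it. [folklore] -/
theorem exists_zsmul_eq_of_card_eq (hV : ∀ v : V, p • v = 0) {H : AddSubgroup V} (hH : Nat.card H = p)
    {f : V} (hf : f ∈ H) (hf0 : f ≠ 0) {u : V} (hu : u ∈ H) : ∃ k : ℤ, u = k • f := by
  have hle : AddSubgroup.zmultiples f ≤ H := AddSubgroup.zmultiples_le_of_mem hf
  have hcard : Nat.card (AddSubgroup.zmultiples f) = p := by
    rw [Nat.card_zmultiples, addOrderOf_eq_of_ne_zero hV hf0]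
  haveI : Finite H := Nat.finite_of_card_ne_zero (by rw [hH]; exact hp.out.ne_zero)
  have heq : AddSubgroup.zmultiples f = H :=
    AddSubgroup.eq_of_le_of_card_ge hle (by rw [hH, hcard])
  have hu' : u ∈ AddSubgroup.zmultiples f := heq ▸ hu
  obtain ⟨k, hk⟩ := AddSubgroup.mem_zmultiples_iff.mp hu'
  exact ⟨k, hk.symm⟩

/-- Two subgroups of order `p`, the first containing an element outside the second, meet trivially. [folklore] -/
theorem inf_eq_bot_of_card_eq (hV : ∀ v : V, p • v = 0) {F T : AddSubgroup V} (hF : Nat.card F = p)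
    {f : V} (hf : f ∈ F) (hfT : f ∉ T) : F ⊓ T = ⊥ := by
  haveI : Finite F := Nat.finite_of_card_ne_zero (by rw [hF]; exact hp.out.ne_zero)
  rw [eq_bot_iff]
  intro u hu
  obtain ⟨huF, huT⟩ := AddSubgroup.mem_inf.mp hu
  by_contra hu0
  -- `u ≠ 0` generates `F`, so `f ∈ ℤ u ⊆ T`
  have hcardu : Nat.card (AddSubgroup.zmultiples u) = p := by
    rw [Nat.card_zmultiples, addOrderOf_eq_of_ne_zero hV hu0]
  have hle : AddSubgroup.zmultiples u ≤ F := AddSubgroup.zmultiples_le_of_mem huF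
  have heq : AddSubgroup.zmultiples u = F := AddSubgroup.eq_of_le_of_card_ge hle (by rw [hF, hcardu])
  have hf' : f ∈ AddSubgroup.zmultiples u := heq ▸ hf
  obtain ⟨k, hk⟩ := AddSubgroup.mem_zmultiples_iff.mp hf'
  exact hfT (hk ▸ T.zsmul_mem huT k)

/-- In a group of order `p²`, two subgroups of order `p` meeting trivially span: every element is a sum. [folklore] -/
theorem exists_add_eq_of_card (hVcard : Nat.card V = p ^ 2) {F T : AddSubgroup V} (hF : Nat.card F = p)
    (hT : Nat.card T = p) (hFT : F ⊓ T = ⊥) (a : V) : ∃ f ∈ F, ∃ t ∈ T, f + t = a := by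
  haveI : Finite V := Nat.finite_of_card_ne_zero (by rw [hVcard]; exact pow_ne_zero 2 hp.out.ne_zero)
  let φ : F × T → V := fun x ↦ (x.1 : V) + (x.2 : V)
  have hinj : Function.Injective φ := by
    rintro ⟨⟨f, hf⟩, ⟨t, ht⟩⟩ ⟨⟨f', hf'⟩, ⟨t', ht'⟩⟩ h
    change f + t = f' + t' at h
    -- `f - f' = t' - t ∈ F ⊓ T = ⊥`
    have hmem : f - f' ∈ F ⊓ T := by
      refine AddSubgroup.mem_inf.mpr ⟨F.sub_mem hf hf', ?_⟩
      have : f - f' = t' - t := by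
        rw [sub_eq_sub_iff_add_eq_add, h, add_comm]
      rw [this]
      exact T.sub_mem ht' ht
    rw [hFT, AddSubgroup.mem_bot, sub_eq_zero] at hmem
    subst hmem
    have ht2 : t = t' := add_left_cancel h
    subst ht2
    rfl
  have hbij : Function.Bijective φ := (Nat.bijective_iff_injective_and_card φ).mpr
    ⟨hinj, by rw [Nat.card_prod, hF, hT, hVcard, sq]⟩
  obtain ⟨⟨f, t⟩, hft⟩ := hbij.2 a
  exact ⟨f.1, f.2, t.1, t.2, hft⟩

/-- The order of a subgroup of a group of order `p²` is `1`, `p` or `p²`. [folklore] -/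
theorem card_eq_of_le_sq (hVcard : Nat.card V = p ^ 2) (H : AddSubgroup V) :
    Nat.card H = 1 ∨ Nat.card H = p ∨ Nat.card H = p ^ 2 := by
  have hdvd : Nat.card H ∣ p ^ 2 := hVcard ▸ H.card_addSubgroup_dvd_card
  obtain ⟨i, hi, hH⟩ := (Nat.dvd_prime_pow hp.out).mp hdvd
  interval_cases i
  · left; simpa using hH
  · right; left; simpa using hH
  · right; right; exact hH

end PrimeOrder

/-! ## §2 The two-plane lemma -/

section TwoPlanes

variable {V₁ V₂ : Type*} [AddCommGroup V₁] [AddCommGroup V₂] {p : ℕ} [hp : Fact p.Prime]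

/-- Integer multiples inside a `ZMod p`-valued biadditive pairing (left slot). [folklore] -/
theorem pairing_zsmul_left {A B : Type*} [AddCommGroup A] [AddCommGroup B] (b : A →+ B →+ ZMod p) (k : ℤ)
    (a : A) (c : B) : b (k • a) c = (k : ZMod p) * b a c := by
  rw [map_zsmul, AddMonoidHom.zsmul_apply, zsmul_eq_mul]

/-- Integer multiples inside a `ZMod p`-valued biadditive pairing (right slot). [folklore] -/
theorem pairing_zsmul_right {A B : Type*} [AddCommGroup A] [AddCommGroup B] (b : A →+ B →+ ZMod p) (k : ℤ)
    (a : A) (c : B) : b a (k • c) = (k : ZMod p) * b a c := by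
  rw [map_zsmul, zsmul_eq_mul]

/-- **THE TWO-PLANE LEMMA.** Let `p` be an odd prime; `V₁, V₂` abelian groups of order `p²` killed by `p`, each with a
SYMMETRIC biadditive `ZMod p`-valued pairing `b_i` with trivial right kernel, and two isotropic subgroups `F_i, T_i` of
order `p`; let `Λ ≤ V₁ × V₂` have order `p²` and be isotropic for `b₁ ⊕ b₂`; let `x̂ ∈ Λ` have `x̂_i ∈ F_i ∖ T_i`, and
suppose every element of `Λ` with both coordinates in `F_i` is an integer multiple of `x̂`. Then `Λ ∩ (T₁ × T₂)` has
exactly `p` elements. (W. Zhang's Lemma 5.3 ∕ Prop. 5.4 at two admissible primes, linear-algebra half; see the module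
docstring for the proof.) [cite: WZhang2014, Lemma 5.3, Prop. 5.4] [cite: KlagsbrunMazurRubin2013, Thm. 3.1 (i)] -/
theorem natCard_inf_prod_eq (hp2 : p ≠ 2)
    (hV₁ : ∀ v : V₁, p • v = 0) (hV₂ : ∀ v : V₂, p • v = 0)
    (hV₁card : Nat.card V₁ = p ^ 2) (hV₂card : Nat.card V₂ = p ^ 2)
    (b₁ : V₁ →+ V₁ →+ ZMod p) (b₂ : V₂ →+ V₂ →+ ZMod p)
    (hsymm₁ : ∀ a a', b₁ a a' = b₁ a' a) (hsymm₂ : ∀ a a', b₂ a a' = b₂ a' a)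
    (hnd₁ : ∀ a, (∀ a', b₁ a' a = 0) → a = 0) (hnd₂ : ∀ a, (∀ a', b₂ a' a = 0) → a = 0)
    (F₁ T₁ : AddSubgroup V₁) (F₂ T₂ : AddSubgroup V₂)
    (hF₁ : Nat.card F₁ = p) (hT₁ : Nat.card T₁ = p) (hF₂ : Nat.card F₂ = p) (hT₂ : Nat.card T₂ = p)
    (hF₁iso : ∀ a ∈ F₁, ∀ a' ∈ F₁, b₁ a a' = 0) (hT₁iso : ∀ a ∈ T₁, ∀ a' ∈ T₁, b₁ a a' = 0)
    (hF₂iso : ∀ a ∈ F₂, ∀ a' ∈ F₂, b₂ a a' = 0) (hT₂iso : ∀ a ∈ T₂, ∀ a' ∈ T₂, b₂ a a' = 0)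
    (Λ : AddSubgroup (V₁ × V₂)) (hΛcard : Nat.card Λ = p ^ 2)
    (hΛiso : ∀ l ∈ Λ, ∀ l' ∈ Λ, b₁ l.1 l'.1 + b₂ l.2 l'.2 = 0)
    (x : V₁ × V₂) (hx : x ∈ Λ) (hxF₁ : x.1 ∈ F₁) (hxF₂ : x.2 ∈ F₂) (hxT₁ : x.1 ∉ T₁) (hxT₂ : x.2 ∉ T₂)
    (hline : ∀ l ∈ Λ, l.1 ∈ F₁ → l.2 ∈ F₂ → ∃ k : ℤ, l = k • x) :
    Nat.card (Λ ⊓ T₁.prod T₂ : AddSubgroup (V₁ × V₂)) = p := by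
  have hpp : p.Prime := hp.out
  haveI : Finite Λ := Nat.finite_of_card_ne_zero (by rw [hΛcard]; exact pow_ne_zero 2 hpp.ne_zero)
  have hV : ∀ l : V₁ × V₂, p • l = 0 := fun l ↦ Prod.ext (hV₁ l.1) (hV₂ l.2)
  have hx0₁ : x.1 ≠ 0 := fun h ↦ hxT₁ (h ▸ T₁.zero_mem)
  have hx0₂ : x.2 ≠ 0 := fun h ↦ hxT₂ (h ▸ T₂.zero_mem)
  have hx0 : x ≠ 0 := fun h ↦ hx0₁ (by rw [h]; rfl)
  -- `F_i ∩ T_i = 0` and `V_i = F_i + T_i`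
  have hFT₁ : F₁ ⊓ T₁ = ⊥ := inf_eq_bot_of_card_eq hV₁ hF₁ hxF₁ hxT₁
  have hFT₂ : F₂ ⊓ T₂ = ⊥ := inf_eq_bot_of_card_eq hV₂ hF₂ hxF₂ hxT₂
  -- §a. an element of `Λ` off the line `ℤ x`
  have hcardx : Nat.card (AddSubgroup.zmultiples x) = p := by
    rw [Nat.card_zmultiples, addOrderOf_eq_prime (hV x) hx0]
  obtain ⟨y, hyΛ, hyx⟩ : ∃ y ∈ Λ, y ∉ AddSubgroup.zmultiples x := by
    by_contra! hall
    have hle : Λ ≤ AddSubgroup.zmultiples x := hall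
    haveI : Finite (AddSubgroup.zmultiples x) := Nat.finite_of_card_ne_zero (by rw [hcardx]; exact hpp.ne_zero)
    have h := AddSubgroup.card_le_of_le hle
    rw [hΛcard, hcardx, sq] at h
    have : p * p ≤ p * 1 := by simpa using h
    have h1 : p ≤ 1 := Nat.le_of_mul_le_mul_left this hpp.pos
    exact absurd h1 (not_le.mpr hpp.one_lt)
  -- §b. decompose the coordinates of `y` along `V_i = F_i ⊕ T_i`, `u_i = α_i • x_i`
  obtain ⟨u₁, hu₁, w₁, hw₁, hy₁⟩ := exists_add_eq_of_card hV₁card hF₁ hT₁ hFT₁ y.1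
  obtain ⟨u₂, hu₂, w₂, hw₂, hy₂⟩ := exists_add_eq_of_card hV₂card hF₂ hT₂ hFT₂ y.2
  obtain ⟨α₁, hα₁⟩ := exists_zsmul_eq_of_card_eq hV₁ hF₁ hxF₁ hx0₁ hu₁
  obtain ⟨α₂, hα₂⟩ := exists_zsmul_eq_of_card_eq hV₂ hF₂ hxF₂ hx0₂ hu₂
  set c₁ : ZMod p := b₁ w₁ x.1 with hc₁
  set c₂ : ZMod p := b₂ w₂ x.2 with hc₂
  -- §c. isotropy against `x`: `c₁ + c₂ = 0`
  have hsum : c₁ + c₂ = 0 := by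
    have h := hΛiso y hyΛ x hx
    rw [← hy₁, ← hy₂, map_add, map_add, AddMonoidHom.add_apply, AddMonoidHom.add_apply,
      hF₁iso u₁ hu₁ x.1 hxF₁, hF₂iso u₂ hu₂ x.2 hxF₂, zero_add, zero_add] at h
    exact h
  -- §d. isotropy against itself (SYMMETRY): `2 (α₁ c₁ + α₂ c₂) = 0`, hence `(α₁ − α₂) c₁ = 0`
  have hself : (α₁ : ZMod p) * c₁ + (α₂ : ZMod p) * c₂ = 0 := by
    have h := hΛiso y hyΛ y hyΛ
    rw [← hy₁, ← hy₂] at h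
    simp only [map_add, AddMonoidHom.add_apply] at h
    rw [hF₁iso u₁ hu₁ u₁ hu₁, hT₁iso w₁ hw₁ w₁ hw₁, hF₂iso u₂ hu₂ u₂ hu₂, hT₂iso w₂ hw₂ w₂ hw₂,
      hsymm₁ u₁ w₁, hsymm₂ u₂ w₂, hα₁, hα₂, pairing_zsmul_right, pairing_zsmul_right] at h
    -- `h : 0 + α₁ c₁ + (α₁ c₁ + 0) + (0 + α₂ c₂ + (α₂ c₂ + 0)) = 0`
    have h2 : (2 : ZMod p) * ((α₁ : ZMod p) * c₁ + (α₂ : ZMod p) * c₂) = 0 := by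
      rw [← h]; ring
    have h2ne : (2 : ZMod p) ≠ 0 := by
      intro h0
      have : (p : ℕ) ∣ 2 := by
        have := (ZMod.natCast_eq_zero_iff 2 p).mp (by exact_mod_cast h0)
        exact this
      have hle := Nat.le_of_dvd two_pos this
      interval_cases p
      · exact absurd hpp (by decide)
      · exact absurd hpp (by decide)
      · exact hp2 rfl
    exact (mul_eq_zero.mp h2).resolve_left h2ne
  have hc₂' : c₂ = -c₁ := by rw [← sub_eq_zero, sub_neg_eq_add, add_comm]; exact hsum
  have hkey : ((α₁ : ZMod p) - (α₂ : ZMod p)) * c₁ = 0 := by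
    rw [hc₂'] at hself
    rw [← hself]; ring
  -- §e. `c₁ ≠ 0`: otherwise `w₁ = w₂ = 0` and `y ∈ F₁ × F₂`, so `y ∈ ℤ x`
  have hc₁0 : c₁ ≠ 0 := by
    intro hc0
    have hc0' : c₂ = 0 := by rw [hc₂', hc0, neg_zero]
    -- `w_i` is right-orthogonal to `F_i + T_i = V_i`
    have hw₁0 : w₁ = 0 := by
      refine hnd₁ w₁ fun a' ↦ ?_
      obtain ⟨f, hf, t, ht, rfl⟩ := exists_add_eq_of_card hV₁card hF₁ hT₁ hFT₁ a'
      obtain ⟨k, rfl⟩ := exists_zsmul_eq_of_card_eq hV₁ hF₁ hxF₁ hx0₁ hf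
      rw [map_add, AddMonoidHom.add_apply, pairing_zsmul_left, hsymm₁ x.1 w₁, ← hc₁, hc0, mul_zero, zero_add,
        hT₁iso t ht w₁ hw₁]
    have hw₂0 : w₂ = 0 := by
      refine hnd₂ w₂ fun a' ↦ ?_
      obtain ⟨f, hf, t, ht, rfl⟩ := exists_add_eq_of_card hV₂card hF₂ hT₂ hFT₂ a'
      obtain ⟨k, rfl⟩ := exists_zsmul_eq_of_card_eq hV₂ hF₂ hxF₂ hx0₂ hf
      rw [map_add, AddMonoidHom.add_apply, pairing_zsmul_left, hsymm₂ x.2 w₂, ← hc₂, hc0', mul_zero, zero_add,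
        hT₂iso t ht w₂ hw₂]
    have hyF₁ : y.1 ∈ F₁ := by rw [← hy₁, hw₁0, add_zero]; exact hu₁
    have hyF₂ : y.2 ∈ F₂ := by rw [← hy₂, hw₂0, add_zero]; exact hu₂
    obtain ⟨k, hk⟩ := hline y hyΛ hyF₁ hyF₂
    exact hyx (AddSubgroup.mem_zmultiples_iff.mpr ⟨k, hk.symm⟩)
  -- §f. so `α₁ ≡ α₂ (mod p)` and `z := y − α₁ • x ∈ Λ ∩ (T₁ × T₂)` is non-zero
  have hα : ((α₁ - α₂ : ℤ) : ZMod p) = 0 := by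
    push_cast
    exact (mul_eq_zero.mp hkey).resolve_right hc₁0
  have hαdvd : (p : ℤ) ∣ α₁ - α₂ := (ZMod.intCast_zmod_eq_zero_iff_dvd _ p).mp hα
  have hα₂x : α₂ • x.2 = α₁ • x.2 := by
    obtain ⟨m, hm⟩ := hαdvd
    have : α₁ = α₂ + p * m := by linarith
    rw [this, add_zsmul, mul_zsmul, natCast_zsmul, hV₂ _, add_zero]
  set z : V₁ × V₂ := y - α₁ • x with hz
  have hzΛ : z ∈ Λ := Λ.sub_mem hyΛ (Λ.zsmul_mem hx α₁)
  have hz₁ : z.1 = w₁ := by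
    change y.1 - (α₁ • x).1 = w₁
    rw [Prod.smul_fst, ← hy₁, hα₁]; abel
  have hz₂ : z.2 = w₂ := by
    change y.2 - (α₁ • x).2 = w₂
    rw [Prod.smul_snd, ← hy₂, hα₂, hα₂x]; abel
  have hzT : z ∈ T₁.prod T₂ := by
    rw [AddSubgroup.mem_prod, hz₁, hz₂]
    exact ⟨hw₁, hw₂⟩
  have hz0 : z ≠ 0 := by
    intro h0
    apply hyx
    rw [hz, sub_eq_zero] at h0
    exact AddSubgroup.mem_zmultiples_iff.mpr ⟨α₁, h0.symm⟩
  -- §g. the order of `Λ ∩ (T₁ × T₂)`: at least `p` (it contains `z`), divides `p²`, not `p²` (`x ∉ T₁ × T₂`)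
  set M : AddSubgroup (V₁ × V₂) := Λ ⊓ T₁.prod T₂ with hM
  haveI : Finite M := Finite.of_injective _ (AddSubgroup.inclusion_injective (inf_le_left : M ≤ Λ))
  have hzM : z ∈ M := AddSubgroup.mem_inf.mpr ⟨hzΛ, hzT⟩
  have hMcard : Nat.card (M.addSubgroupOf Λ) = Nat.card M :=
    Nat.card_congr (AddSubgroup.addSubgroupOfEquivOfLe (inf_le_left : M ≤ Λ)).toEquiv
  rcases card_eq_of_le_sq (V := Λ) (p := p) hΛcard (M.addSubgroupOf Λ) with h1 | hP | hsq
  · -- order 1: contradicts `z ≠ 0`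
    exfalso
    have hbot : M.addSubgroupOf Λ = ⊥ := AddSubgroup.eq_bot_of_card_eq _ h1
    have : (⟨z, hzΛ⟩ : Λ) ∈ M.addSubgroupOf Λ := AddSubgroup.mem_addSubgroupOf.mpr hzM
    rw [hbot, AddSubgroup.mem_bot] at this
    exact hz0 (congrArg Subtype.val this)
  · rw [← hMcard, hP]
  · -- order p²: `M = Λ ∋ x`, contradicting `x.1 ∉ T₁`
    exfalso
    have htop : M.addSubgroupOf Λ = ⊤ := by
      exact AddSubgroup.eq_top_of_card_eq _ (by rw [hsq, hΛcard])
    have : (⟨x, hx⟩ : Λ) ∈ M.addSubgroupOf Λ := by rw [htop]; exact AddSubgroup.mem_top _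
    rw [AddSubgroup.mem_addSubgroupOf] at this
    have hxT := (AddSubgroup.mem_inf.mp this).2
    rw [AddSubgroup.mem_prod] at hxT
    exact hxT₁ hxT.1

end TwoPlanes

end Summit.BirchSwinnertonDyer.BirchSwinnertonDyer.Theorems.AdditiveKoly.TwoPlanes
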